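import Literature.AlgebraicGeometry.Motives.UnitaryPeriodDomainFundamentalWeights
import Literature.AlgebraicGeometry.Motives.UnitaryPeriodDomainFundamentalSystemConjugacy
import HarnessLib

/-!
# `ρ = ½ Σ_{α∈Σ⁺} m_α α` for `SU(p,q)`: the half-sum of the positive restricted roots counted with multiplicities, in closed form `ρ = Σ_i (p + q − 2i + 1) ξ_i`
# (Al-Hashami–Anchouche §5: `ρ = Σ_{i=1}^q (k + 1 + 2(q − i)) α_i`, `k = p − q`), its pairings `⟨ρ, γ^∨⟩ = m_γ + 2m_{2γ}` with `Δ^∨`, and `ρ ∈ 𝔞⁺`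

Layer `Literature/AlgebraicGeometry/Motives`, namespace `Literature.AlgebraicGeometry.Motives`; lane `lit-hodgefound` (Track 2 foundations library),
Layer A (the period domain `I_{p,q} = SU(p,q)/S(U(p)×U(q))`; prover seat p13, generation 22, thirteenth file — the item «`δ` for `𝔯` counted with multiplicities (`ρ = ½Σ m_α α`)» listed
under NOT here in `Motives/UnitaryPeriodDomainFundamentalWeights`).  Sequel, BY NAME, of `Motives/UnitaryPeriodDomainRestrictedRoots` (`restrictedRootSpace p q α = 𝔤_α`, the
multiplicities `finrank_restrictedRootSpace_single_add_single/_single_sub_single = 2`, `finrank_restrictedRootSpace_single_two = 1`, `finrank_restrictedRootSpace_single = 2(p + q − 2r)`,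
`restrictedRoots_subset_rootSystemTypeBC`, `two_single_mem_restrictedRoots`, `single_mem_restrictedRoots`, `single_not_mem_restrictedRoots`), of `Motives/UnitaryPeriodDomainHalfSumPositiveRoots`
(`posRootsFinset p q = 𝔯⁺`, `mem_posRootsFinset_iff`, `halfSumPosRoots p q = δ = ½Σ_{β>0} β`), of `Motives/UnitaryPeriodDomainFundamentalWeights` (`halfSumPosRoots_apply` : `δ_i = (r − i) + (0 |
½)`, `fundamentalWeight` = `ω_k`, `eq_sum_coroot_dotProduct_smul_fundamentalWeight` : `v = Σ (γ_k^∨, v)ω_k`, `coroot_simpleRootIndex_dotProduct`), of `Motives/UnitaryPeriodDomainFundamentalSystem`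
(`IsLexPos`, `isLexPos_single`, `isLexPos_single_add_single`, `IsLexPos.not_neg`, `fundamentalRoot_of_lt`) , of `Motives/UnitaryPeriodDomainRootPairingBase` (`simpleRootIndex`,
`restrictedRootPairing_coroot_simpleRootIndex_of_lt/_last_of_eq/_last_of_ne`) and of `Motives/UnitaryPeriodDomainFundamentalSystemConjugacy` (`weylChamberFundamental = 𝔞⁺`,
`mem_weylChamberFundamental_iff`); Mathlib: `Finset.sum_filter`, `Finset.sum_image`, `Finset.sum_ite_eq`.  One definition with body (`weightedHalfSumPosRoots`) and PROVED theorems;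
no named fact, no `sorry` (net debt 0); no instance, no notation.

## Sources, verbatim

M. Al-Hashami, B. Anchouche, *Convolution of χ-orbital measures on complex Grassmannians* (J. Lie Theory 28 (2018); arXiv:2107.10914) [AlhashamiAnchouche2021], §5 (p. 9), `U = SU(p,q)`,
`p > q`, `k = p − q`: «the corresponding system of positive restricted roots `Σ⁺` consists of `α_i, 2α_i (1 ≤ i ≤ q)`, and `(α_i ± α_j)`, `(1 ≤ i < j ≤ q)`. Let `ρ = ½ Σ_{α∈Σ⁺} m_α α`.
Then `ρ = ½(Σ_{i=1}^q 2kα_i + Σ_{i=1}^q 2α_i + Σ_{i=1}^q 4(q − i)α_i) = Σ_{i=1}^q (k + 1 + 2(q − i)) α_i`», with (same §) «multiplicities `m_{α_i} = 2k`, `m_{2α_i} = 1`, and `m_{α_i±α_j} = 2`».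
I. Satake, *Algebraic Structures of Symmetric Domains* (1980) [Satake1980AlgebraicStructures], II §4 p0084: «The multiplicity of roots can be found in Loos [1], Vol. II, p. 162, Table 1»;
II §4 (4.19) (the roots of `(I_{p,q})`); I §5 p0034 (`𝔤 = 𝔠(𝔞) + Σ_{α∈𝔯} 𝔤_α`).
J. E. Humphreys, *Introduction to Lie Algebras and Representation Theory* (1972) [Humphreys1972], §13.3 Lemma A (p. 70) (the reduced case `m ≡ 1`: `⟨δ, α_i⟩ = 1`, `δ = Σ λ_j`).

## The dictionary and what is formalized (`r = min(p, q)`, 0-indexed `ξ_0, …, ξ_{r−1}`; `m_β = dim_ℂ 𝔤_β`; `k = p + q − 2r = |p − q|`)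

* §1 `weightedHalfSumPosRoots p q = ρ := ½ Σ_{β∈𝔯⁺} m_β β`; the positive roots `2ξ_i` (all `p, q`) and `ξ_i` (`p ≠ q`) as images in `𝔯⁺` (`posRootsFinset_filter_eq_image_*`), and the pointwise
  weight `m_β β = 2β − [β = 2ξ_i]β + [β = ξ_i](2k − 2)β` on `𝔯⁺` (`finrank_smul_eq_of_mem_posRootsFinset`).
* §2 ★ **`Σ_{β∈𝔯⁺} m_β β = 2Σ_{β∈𝔯⁺} β − Σ_i 2ξ_i + [p ≠ q](2k − 2)Σ_i ξ_i`** (`sum_posRootsFinset_finrank_smul`), hence with `δ = ½Σ_{β>0}β` in closed form: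
  ★ **`ρ_i = (p + q) − 2i − 1`** (`weightedHalfSumPosRoots_apply`; 1-indexed: `p + q − 2i + 1`, Al-Hashami–Anchouche's `k + 1 + 2(q − i)`), uniformly in `p, q`.
* §3 ★ **`(γ_k^∨, ρ) = 2 = m_{γ_k}` for `k + 1 < r`; `(γ_r^∨, ρ) = 1 = m_{2ξ} ` for `p = q`; `(γ_r^∨, ρ) = 2k + 2 = m_{ξ} + 2m_{2ξ}` for `p ≠ q`** (`coroot_simpleRootIndex_dotProduct_weightedHalfSumPosRoots_*`),
  so ★ `ρ = 2ω_1 + ⋯ + 2ω_{r−1} + (1 | 2k + 2)ω_r` (`weightedHalfSumPosRoots_eq_sum_smul_fundamentalWeight`); ★ **`ρ ∈ 𝔞⁺`** (strictly decreasing positive coordinates).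

NOT here: `ρ` for `S(U(p)×U(q))`-spherical analysis (`c`-function, Plancherel); the relation `ρ = ρ_𝔤|_𝔞` with the half-sum of positive roots of `𝔰𝔩(p+q, ℂ)`.  The Hodge conjecture is not
addressed.
-/

noncomputable section

open Module Finset
open scoped Matrix

namespace Literature.AlgebraicGeometry.Motives

variable {p q : ℕ}

section Definition

/-! ### §1 `ρ = ½ Σ_{β>0} m_β β` and the special positive roots `2ξ_i`, `ξ_i` -/

variable (p q) in
/-- **`ρ = ½ Σ_{α∈Σ⁺} m_α α`, the half-sum of the positive restricted roots of `(𝔰𝔲(p,q), 𝔞)` counted with multiplicities `m_α = dim 𝔤_α`.** [cite: AlhashamiAnchouche2021, §5 p. 9 («Let `ρ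
= ½ Σ_{α∈Σ⁺} m_α α`»)] [cite: Satake1980AlgebraicStructures, II §4 p0084 («the multiplicity of roots»)] -/
def weightedHalfSumPosRoots : Fin (min p q) → ℝ :=
  (2⁻¹ : ℝ) • ∑ β ∈ posRootsFinset p q, (finrank ℂ (restrictedRootSpace p q β) : ℝ) • β

/-- `Σ_{β>0} β = 2δ`. [cite: Humphreys1972, §10.2 Corollary to Lemma B p. 50 («`δ = ½ Σ_{β≻0} β`»)] -/
theorem sum_posRootsFinset_eq_two_smul_halfSumPosRoots : ∑ β ∈ posRootsFinset p q, β = (2 : ℝ) • halfSumPosRoots p q := by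
  rw [halfSumPosRoots, smul_smul]
  norm_num

/-- `i ↦ cξ_i` is injective for `c ≠ 0`. [folklore] -/
private theorem single_const_injective {r : ℕ} {c : ℝ} (hc : c ≠ 0) : Function.Injective fun i : Fin r => (Pi.single i c : Fin r → ℝ) := fun i j h => by
  by_contra hij
  have h' := congrFun h i
  simp only [Pi.single_eq_same, Pi.single_apply, if_neg hij] at h'
  exact hc h'

/-- `Σ_i cξ_i = (c, …, c)`. [folklore] -/
private theorem sum_single_const {r : ℕ} (c : ℝ) : ∑ i : Fin r, (Pi.single i c : Fin r → ℝ) = fun _ => c := by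
  funext j
  simp only [Finset.sum_apply, Pi.single_apply, Finset.sum_ite_eq, Finset.mem_univ, if_true]

/-- `2ξ_i ∈ 𝔯⁺`. [cite: Satake1980AlgebraicStructures, II §4 (4.19)] [cite: AlhashamiAnchouche2021, §5 p. 9 («`2α_i (1 ≤ i ≤ q)`»)] -/
theorem two_single_mem_posRootsFinset (i : Fin (min p q)) : (Pi.single i 2 : Fin (min p q) → ℝ) ∈ posRootsFinset p q :=
  (mem_posRootsFinset_iff _).2 ⟨two_single_mem_restrictedRoots i, isLexPos_single i two_pos⟩

/-- `ξ_i ∈ 𝔯⁺` for `p ≠ q`. [cite: Satake1980AlgebraicStructures, II §4 (4.19)] [cite: AlhashamiAnchouche2021, §5 p. 9 («`α_i … (1 ≤ i ≤ q)`»)] -/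
theorem single_mem_posRootsFinset (hpq : p ≠ q) (i : Fin (min p q)) : (Pi.single i 1 : Fin (min p q) → ℝ) ∈ posRootsFinset p q :=
  (mem_posRootsFinset_iff _).2 ⟨single_mem_restrictedRoots hpq i, isLexPos_single i one_pos⟩

/-- The positive roots of the form `2ξ_i` are exactly the image of `i ↦ 2ξ_i`. [cite: Satake1980AlgebraicStructures, II §4 (4.19)] -/
theorem posRootsFinset_filter_eq_image_two_single [DecidableEq (Fin (min p q) → ℝ)] [DecidablePred fun β : Fin (min p q) → ℝ => ∃ i, β = Pi.single i 2] :
    (posRootsFinset p q).filter (fun β => ∃ i, β = Pi.single i 2) = Finset.univ.image fun i : Fin (min p q) => (Pi.single i 2 : Fin (min p q) → ℝ) := by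
  ext β
  simp only [Finset.mem_filter, Finset.mem_image, Finset.mem_univ, true_and]
  constructor
  · rintro ⟨-, i, rfl⟩
    exact ⟨i, rfl⟩
  · rintro ⟨i, rfl⟩
    exact ⟨two_single_mem_posRootsFinset i, i, rfl⟩

/-- For `p ≠ q` the positive roots `ξ_i` are the image of `i ↦ ξ_i`. [cite: Satake1980AlgebraicStructures, II §4 (4.19)] -/
theorem posRootsFinset_filter_eq_image_single [DecidableEq (Fin (min p q) → ℝ)] [DecidablePred fun β : Fin (min p q) → ℝ => ∃ i, β = Pi.single i 1] (hpq : p ≠ q) :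
    (posRootsFinset p q).filter (fun β => ∃ i, β = Pi.single i 1) = Finset.univ.image fun i : Fin (min p q) => (Pi.single i 1 : Fin (min p q) → ℝ) := by
  ext β
  simp only [Finset.mem_filter, Finset.mem_image, Finset.mem_univ, true_and]
  constructor
  · rintro ⟨-, i, rfl⟩
    exact ⟨i, rfl⟩
  · rintro ⟨i, rfl⟩
    exact ⟨single_mem_posRootsFinset hpq i, i, rfl⟩

/-- For `p = q` no `ξ_i` is a root. [cite: Satake1980AlgebraicStructures, II §4 (4.19) (type `(C_r)`)] -/
theorem posRootsFinset_filter_eq_empty [DecidablePred fun β : Fin (min p q) → ℝ => ∃ i, β = Pi.single i 1] (hpq : p = q) :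
    (posRootsFinset p q).filter (fun β => ∃ i, β = Pi.single i 1) = ∅ := by
  refine Finset.filter_eq_empty_iff.2 ?_
  rintro β hβ ⟨i, rfl⟩
  exact single_not_mem_restrictedRoots hpq i ((mem_posRootsFinset_iff _).1 hβ).1

/-- `ξ_i + ξ_j` (`i ≠ j`) is neither `2ξ_l` nor `ξ_l`. [folklore] -/
private theorem single_add_single_ne {r : ℕ} {i j : Fin r} (hij : i ≠ j) (l : Fin r) :
    (Pi.single i 1 + Pi.single j 1 : Fin r → ℝ) ≠ Pi.single l 2 ∧ (Pi.single i 1 + Pi.single j 1 : Fin r → ℝ) ≠ Pi.single l 1 := by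
  constructor
  · intro h
    have h' := congrFun h i
    simp only [Pi.add_apply, Pi.single_eq_same, Pi.single_apply, if_neg hij] at h'
    split_ifs at h' <;> norm_num at h'
  · intro h
    have hs := congrArg (fun v : Fin r → ℝ => ∑ a, v a) h
    simp only [Pi.add_apply] at hs
    rw [Finset.sum_add_distrib, Fintype.sum_pi_single', Fintype.sum_pi_single', Fintype.sum_pi_single'] at hs
    norm_num at hs

/-- `ξ_i − ξ_j` (`i ≠ j`) is neither `2ξ_l` nor `ξ_l`. [folklore] -/
private theorem single_sub_single_ne {r : ℕ} {i j : Fin r} (hij : i ≠ j) (l : Fin r) :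
    (Pi.single i 1 - Pi.single j 1 : Fin r → ℝ) ≠ Pi.single l 2 ∧ (Pi.single i 1 - Pi.single j 1 : Fin r → ℝ) ≠ Pi.single l 1 := by
  constructor <;>
  · intro h
    have h' := congrFun h j
    simp only [Pi.sub_apply, Pi.single_eq_same, Pi.single_apply, if_neg (Ne.symm hij)] at h'
    split_ifs at h' <;> norm_num at h'

/-- `2ξ_i ≠ ξ_l`. [folklore] -/
private theorem two_single_ne_single {r : ℕ} (i l : Fin r) : (Pi.single i 2 : Fin r → ℝ) ≠ Pi.single l 1 := by
  intro h
  have h' := congrFun h i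
  simp only [Pi.single_eq_same, Pi.single_apply] at h'
  split_ifs at h' <;> norm_num at h'

/-- **The weight `m_β β` on `𝔯⁺`, pointwise: `m_β β = 2β − [β = 2ξ_i]β + [β = ξ_i](2k − 2)β`** (`m = 2` on `ξ_i ± ξ_j`, `1` on `2ξ_i`, `2k` on `ξ_i`). [cite: AlhashamiAnchouche2021, §5 p. 9
(«`m_{α_i} = 2k`, `m_{2α_i} = 1`, and `m_{α_i±α_j} = 2`»)] [cite: Satake1980AlgebraicStructures, II §4 p0084] -/
theorem finrank_smul_eq_of_mem_posRootsFinset [DecidablePred fun β : Fin (min p q) → ℝ => ∃ i, β = Pi.single i 2]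
    [DecidablePred fun β : Fin (min p q) → ℝ => ∃ i, β = Pi.single i 1] {β : Fin (min p q) → ℝ} (hβ : β ∈ posRootsFinset p q) :
    (finrank ℂ (restrictedRootSpace p q β) : ℝ) • β =
      (2 : ℝ) • β - (if ∃ i, β = Pi.single i 2 then β else 0) + (if ∃ i, β = Pi.single i 1 then (((2 * (p + q - 2 * min p q) : ℕ) : ℝ) - 2) • β else 0) := by
  obtain ⟨hβr, hpos⟩ := (mem_posRootsFinset_iff β).1 hβ
  rcases restrictedRoots_subset_rootSystemTypeBC hβr with (⟨i, j, hij, rfl | rfl | rfl⟩ | ⟨i, rfl | rfl⟩) | ⟨i, rfl | rfl⟩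
  · rw [finrank_restrictedRootSpace_single_add_single hij, if_neg (fun ⟨l, hl⟩ => (single_add_single_ne hij l).1 hl), if_neg (fun ⟨l, hl⟩ => (single_add_single_ne hij l).2 hl)]
    norm_num
  · rw [finrank_restrictedRootSpace_single_sub_single hij, if_neg (fun ⟨l, hl⟩ => (single_sub_single_ne hij l).1 hl), if_neg (fun ⟨l, hl⟩ => (single_sub_single_ne hij l).2 hl)]
    norm_num
  · exact absurd hpos (isLexPos_single_add_single i j).not_neg
  · rw [finrank_restrictedRootSpace_single_two, if_pos ⟨i, rfl⟩, if_neg (fun ⟨l, hl⟩ => two_single_ne_single i l hl)]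
    norm_num
    module
  · exact absurd hpos (isLexPos_single i two_pos).not_neg
  · rw [finrank_restrictedRootSpace_single, if_neg (fun ⟨l, hl⟩ => two_single_ne_single l i hl.symm), if_pos ⟨i, rfl⟩]
    module
  · exact absurd hpos (isLexPos_single i one_pos).not_neg

end Definition

section ClosedForm

/-! ### §2 `Σ_{β>0} m_β β` and the closed form of `ρ` -/

/-- **`Σ_{β∈𝔯⁺} m_β β = 2Σ_{β∈𝔯⁺} β − Σ_i 2ξ_i + [p ≠ q]·(2k − 2)Σ_i ξ_i`** (`k = p + q − 2r`). [cite: AlhashamiAnchouche2021, §5 p. 9 («`ρ = ½(Σ 2kα_i + Σ 2α_i + Σ 4(q − i)α_i)`»)] -/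
theorem sum_posRootsFinset_finrank_smul :
    ∑ β ∈ posRootsFinset p q, (finrank ℂ (restrictedRootSpace p q β) : ℝ) • β =
      (2 : ℝ) • ∑ β ∈ posRootsFinset p q, β - ∑ i : Fin (min p q), (Pi.single i 2 : Fin (min p q) → ℝ) +
        (if p = q then 0 else (((2 * (p + q - 2 * min p q) : ℕ) : ℝ) - 2) • ∑ i : Fin (min p q), (Pi.single i 1 : Fin (min p q) → ℝ)) := by
  classical
  rw [Finset.sum_congr rfl fun β hβ => finrank_smul_eq_of_mem_posRootsFinset hβ, Finset.sum_add_distrib, Finset.sum_sub_distrib, ← Finset.smul_sum, ← Finset.sum_filter,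
    posRootsFinset_filter_eq_image_two_single, Finset.sum_image fun i _ j _ h => single_const_injective two_ne_zero h]
  congr 1
  by_cases hpq : p = q
  · rw [if_pos hpq]
    refine Finset.sum_eq_zero fun β hβ => ?_
    rw [if_neg]
    rintro ⟨i, rfl⟩
    exact single_not_mem_restrictedRoots hpq i ((mem_posRootsFinset_iff _).1 hβ).1
  · rw [if_neg hpq, ← Finset.sum_filter, posRootsFinset_filter_eq_image_single hpq, Finset.sum_image fun i _ j _ h => single_const_injective one_ne_zero h, Finset.smul_sum]

/-- `2r ≤ p + q`. [folklore] -/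
private theorem two_mul_min_le : 2 * min p q ≤ p + q := by
  rcases le_total p q with h | h
  · rw [min_eq_left h]; omega
  · rw [min_eq_right h]; omega

/-- **Closed form: `ρ = Σ_i (p + q − 2i − 1)ξ_i` (0-indexed `i`), i.e. `ρ_i = (p + q) − 2i − 1`** — Al-Hashami–Anchouche's `Σ_{i=1}^q (k + 1 + 2(q − i))α_i` (`p ≥ q`, `k = p − q`, 1-indexed),
uniformly for all `p, q` (for `p = q`: `2r − 2i − 1 = 2δ_i − 1`). [cite: AlhashamiAnchouche2021, §5 p. 9 («`ρ = Σ_{i=1}^q (k + 1 + 2(q − i)) α_i`»)] -/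
theorem weightedHalfSumPosRoots_apply (i : Fin (min p q)) : weightedHalfSumPosRoots p q i = ((p + q : ℕ) : ℝ) - 2 * (i : ℕ) - 1 := by
  have hle := two_mul_min_le (p := p) (q := q)
  rw [weightedHalfSumPosRoots, sum_posRootsFinset_finrank_smul, sum_posRootsFinset_eq_two_smul_halfSumPosRoots, sum_single_const, sum_single_const]
  simp only [Pi.smul_apply, Pi.add_apply, Pi.sub_apply, smul_eq_mul, halfSumPosRoots_apply]
  by_cases hpq : p = q
  · rw [if_pos hpq, if_pos hpq, Pi.zero_apply]
    have h2 : ((p + q : ℕ) : ℝ) = 2 * ((min p q : ℕ) : ℝ) := by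
      rw [hpq, min_self]; push_cast; ring
    rw [h2]
    ring
  · rw [if_neg hpq, if_neg hpq, Pi.smul_apply, smul_eq_mul, mul_one, Nat.cast_mul, Nat.cast_sub hle]
    push_cast
    ring

/-- The coordinates of `ρ` strictly decrease. [cite: AlhashamiAnchouche2021, §5 p. 9] -/
theorem weightedHalfSumPosRoots_strictAnti : StrictAnti (weightedHalfSumPosRoots p q) := fun i j hij => by
  rw [weightedHalfSumPosRoots_apply, weightedHalfSumPosRoots_apply]
  have h : ((i : ℕ) : ℝ) < ((j : ℕ) : ℝ) := by exact_mod_cast Fin.lt_def.1 hij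
  linarith

/-- The last coordinate `ρ_{r−1} = p + q − 2r + 1 ≥ 1`, so all coordinates of `ρ` are positive. [cite: AlhashamiAnchouche2021, §5 p. 9 («`k + 1 + 2(q − i)`»)] -/
theorem weightedHalfSumPosRoots_apply_pos (i : Fin (min p q)) : 0 < weightedHalfSumPosRoots p q i := by
  rw [weightedHalfSumPosRoots_apply]
  have hle := two_mul_min_le (p := p) (q := q)
  have hi : (i : ℕ) + 1 ≤ min p q := i.2
  have h1 : 2 * ((i : ℕ) : ℝ) + 2 ≤ ((p + q : ℕ) : ℝ) := by exact_mod_cast (by omega : 2 * (i : ℕ) + 2 ≤ p + q)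
  linarith

/-- **`ρ ∈ 𝔞⁺`**: `ρ` lies in the open fundamental chamber (`ρ_0 > ρ_1 > ⋯ > ρ_{r−1} > 0`). [cite: AlhashamiAnchouche2021, §5 p. 9] [cite: Humphreys1972, §13.3 Lemma A (p. 70) (the reduced
analogue: «`δ` is a (strongly) dominant weight»)] -/
theorem weightedHalfSumPosRoots_mem_weylChamberFundamental : weightedHalfSumPosRoots p q ∈ weylChamberFundamental p q :=
  (mem_weylChamberFundamental_iff _).2 ⟨weightedHalfSumPosRoots_strictAnti, weightedHalfSumPosRoots_apply_pos⟩

/-- For `p = q`: `ρ = 2δ − (1, …, 1)`, i.e. `ρ_i = 2δ_i − 1`. [cite: AlhashamiAnchouche2021, §5 p. 9] [cite: Humphreys1972, §13.3 Lemma A (p. 70)] -/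
theorem weightedHalfSumPosRoots_apply_of_eq (hpq : p = q) (i : Fin (min p q)) : weightedHalfSumPosRoots p q i = 2 * halfSumPosRoots p q i - 1 := by
  rw [weightedHalfSumPosRoots_apply, halfSumPosRoots_apply_of_eq hpq]
  have hp : (p : ℝ) = ((min p q : ℕ) : ℝ) := by rw [hpq, min_self]
  have hq' : (q : ℝ) = ((min p q : ℕ) : ℝ) := by rw [hpq, min_self]
  push_cast at hp hq' ⊢
  linarith

end ClosedForm

section Pairings

/-! ### §3 `⟨ρ, γ_k^∨⟩` and the expansion on the fundamental weights -/

/-- **`(γ_k^∨, ρ) = ρ_k − ρ_{k+1} = 2 = m_{γ_k}` for `k + 1 < r`** (`γ_k^∨ = γ_k = ξ_k − ξ_{k+1}`, `2γ_k ∉ 𝔯`). [cite: AlhashamiAnchouche2021, §5 p. 9 («`m_{α_i±α_j} = 2`»)] [cite: Humphreys1972,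
§13.3 Lemma A (p. 70)] -/
theorem coroot_simpleRootIndex_dotProduct_weightedHalfSumPosRoots_of_lt {k : Fin (min p q)} (h : (k : ℕ) + 1 < min p q) :
    (restrictedRootPairing p q).coroot (simpleRootIndex p q k) ⬝ᵥ weightedHalfSumPosRoots p q = 2 := by
  rw [restrictedRootPairing_coroot_simpleRootIndex_of_lt h, fundamentalRoot_of_lt h, sub_dotProduct, single_dotProduct, single_dotProduct, one_mul, one_mul,
    weightedHalfSumPosRoots_apply, weightedHalfSumPosRoots_apply]
  simp only
  push_cast
  ring

/-- **`p = q`: `(γ_r^∨, ρ) = (ξ_{r−1}, ρ) = ρ_{r−1} = 1 = m_{2ξ_{r−1}}`.** [cite: AlhashamiAnchouche2021, §5 p. 9 («`m_{2α_i} = 1`»)] -/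
theorem coroot_simpleRootIndex_dotProduct_weightedHalfSumPosRoots_last_of_eq (hpq : p = q) {k : Fin (min p q)} (h : (k : ℕ) + 1 = min p q) :
    (restrictedRootPairing p q).coroot (simpleRootIndex p q k) ⬝ᵥ weightedHalfSumPosRoots p q = 1 := by
  rw [restrictedRootPairing_coroot_simpleRootIndex_last_of_eq hpq h, single_dotProduct, one_mul, weightedHalfSumPosRoots_apply]
  have hk : ((k : ℕ) : ℝ) + 1 = ((min p q : ℕ) : ℝ) := by exact_mod_cast h
  have hp : (p : ℝ) = ((min p q : ℕ) : ℝ) := by rw [hpq, min_self]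
  have hq' : (q : ℝ) = ((min p q : ℕ) : ℝ) := by rw [hpq, min_self]
  push_cast at hk hp hq' ⊢
  linarith

/-- **`p ≠ q`: `(γ_r^∨, ρ) = (2ξ_{r−1}, ρ) = 2ρ_{r−1} = 2k + 2 = m_{ξ} + 2m_{2ξ}`** (`k = p + q − 2r`). [cite: AlhashamiAnchouche2021, §5 p. 9 («`m_{α_i} = 2k`, `m_{2α_i} = 1`»)] -/
theorem coroot_simpleRootIndex_dotProduct_weightedHalfSumPosRoots_last_of_ne (hpq : p ≠ q) {k : Fin (min p q)} (h : (k : ℕ) + 1 = min p q) :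
    (restrictedRootPairing p q).coroot (simpleRootIndex p q k) ⬝ᵥ weightedHalfSumPosRoots p q = (((2 * (p + q - 2 * min p q) : ℕ) : ℝ)) + 2 := by
  have hle := two_mul_min_le (p := p) (q := q)
  rw [restrictedRootPairing_coroot_simpleRootIndex_last_of_ne hpq h, single_dotProduct, weightedHalfSumPosRoots_apply, Nat.cast_mul, Nat.cast_sub hle]
  have hk : ((k : ℕ) : ℝ) + 1 = ((min p q : ℕ) : ℝ) := by exact_mod_cast h
  push_cast at hk ⊢
  linarith

/-- **`ρ = Σ_k (γ_k^∨, ρ)ω_k = 2ω_1 + ⋯ + 2ω_{r−1} + cω_r` with `c = 1` (`p = q`) or `c = 2k + 2` (`p ≠ q`).** [cite: Humphreys1972, §13.1 p. 67 («`λ = Σ m_iλ_i`»), §13.3 Lemma A (p. 70)]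
[cite: AlhashamiAnchouche2021, §5 p. 9] -/
theorem weightedHalfSumPosRoots_eq_sum_smul_fundamentalWeight :
    weightedHalfSumPosRoots p q = ∑ k : Fin (min p q),
      (if (k : ℕ) + 1 < min p q then (2 : ℝ) else if p = q then 1 else (((2 * (p + q - 2 * min p q) : ℕ) : ℝ)) + 2) • fundamentalWeight p q k := by
  conv_lhs => rw [eq_sum_coroot_dotProduct_smul_fundamentalWeight (weightedHalfSumPosRoots p q)]
  refine Finset.sum_congr rfl fun k _ => ?_
  congr 1
  by_cases hk : (k : ℕ) + 1 < min p q
  · rw [if_pos hk, coroot_simpleRootIndex_dotProduct_weightedHalfSumPosRoots_of_lt hk]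
  · have hk' : (k : ℕ) + 1 = min p q := by have := k.2; omega
    rw [if_neg hk]
    by_cases hpq : p = q
    · rw [if_pos hpq, coroot_simpleRootIndex_dotProduct_weightedHalfSumPosRoots_last_of_eq hpq hk']
    · rw [if_neg hpq, coroot_simpleRootIndex_dotProduct_weightedHalfSumPosRoots_last_of_ne hpq hk']

end Pairings

end Literature.AlgebraicGeometry.Motives
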